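import Literature.MathematicalPhysics.QuantumLattice.GibbsVariationalPrinciple
import Literature.MathematicalPhysics.QuantumLattice.SectorPartitionFnCut
import Literature.InformationTheory.Entropy.VonNeumannEntropyOrthogonalSupports
import HarnessLib

/-!
# The Gibbs variational principle for a COMPRESSED Hamiltonian, stated for densities on the big space that are
# supported in the compression (symmetry sectors): `S(ρ) − β Re tr(ρH) ≤ log Z_β(H|_p)`

Topic `Literature/MathematicalPhysics/QuantumLattice` (namespace = path). `GibbsVariationalPrinciple.lean` proves, for a
Hermitian `H` on a finite index type and a density matrix `ρ` ON THE SAME index type,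
`S(ρ) − β Re tr(ρH) ≤ log Re Z_β(H)` (`Matrix.IsHermitian.vonNeumannEntropy_sub_mul_le_log_partitionFn`). The canonical
(sector) partition functions of the lattice-fermion files are partition functions of COMPRESSIONS
`H|_p = H.submatrix val val` to a class `p` of basis states (`spinSectorHamiltonian a b H`, `SectorPartitionFnCut.lean`),
while trial states are naturally written as density matrices on the FULL space that happen to be supported in the sector
(e.g. products of number-conserving box states, sector mixtures). This file packages the bookkeeping
(`VonNeumannEntropyOrthogonalSupports.lean` §1: entropy, trace and `tr(ρH)` are those of the compression) into the form a
reader consumes: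

* `Matrix.IsHermitian.vonNeumannEntropy_sub_mul_le_log_partitionFn_of_support` — `ρ ⪰ 0`, `tr ρ = 1`,
  `ρ_{ij} = 0` whenever `¬ p j` ⇒ `S(ρ) − β Re tr(ρH) ≤ log Re Z_β(H.submatrix val val)`;
* `vonNeumannEntropy_sub_mul_le_log_partitionFn_spinSector` — the same with `p = spinConfig a b`, i.e. against the
  canonical partition function `Z_β(spinSectorHamiltonian a b H)` of the `(N↑, N↓) = (a, b)` sector.

[cite: Israel1979, Lemma II.3.1] (Gibbs variational principle / convexity of `log Z`); [cite: NielsenChuang2010, Theorem 11.8 (4) p.513]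
(entropy of a state supported on a subspace). Everything is PROVED; no definition, no named fact.

## Tree / Mathlib search

REUSED: `Matrix.IsHermitian.vonNeumannEntropy_sub_mul_le_log_partitionFn` (`GibbsVariationalPrinciple`),
`vonNeumannEntropy_eq_submatrix_of_support`, `trace_submatrix_of_support`, `trace_submatrix_mul_submatrix_of_support`,
`apply_eq_zero_of_support_left`, `posSemidef_submatrix_val` (`VonNeumannEntropyOrthogonalSupports`), `spinSectorHamiltonian`,
`spinConfig` (`SectorPartitionFnCut`). `lean search 'le_log_partitionFn.*support|_of_support.*partitionFn'`: nothing (2026-08-27).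
-/

noncomputable section

open scoped ComplexOrder
open Literature.InformationTheory.Entropy

namespace Matrix

variable {n : Type*} [Fintype n] [DecidableEq n]

/-- **Gibbs variational principle against a compressed Hamiltonian**: for Hermitian `H`, a class `p` of basis states, and a
density matrix `ρ` on the full space supported in `p` (`ρ_{ij} = 0` if `¬ p j`),
`S(ρ) − β Re tr(ρH) ≤ log Re Z_β(H|_p)` with `H|_p = H.submatrix val val` on `{i // p i}`. [cite: Israel1979, Lemma II.3.1] -/
theorem IsHermitian.vonNeumannEntropy_sub_mul_le_log_partitionFn_of_support {H : Matrix n n ℂ} (hH : H.IsHermitian)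
    (β : ℝ) (p : n → Prop) [DecidablePred p] {ρ : Matrix n n ℂ} (hρ : ρ.PosSemidef) (htr : ρ.trace = 1)
    (hsupp : ∀ i j, ¬ p j → ρ i j = 0) :
    vonNeumannEntropy ρ - β * (ρ * H).trace.re ≤
      Real.log (partitionFn β (H.submatrix (Subtype.val : {i // p i} → n) Subtype.val)).re := by
  have hsupp' := apply_eq_zero_of_support_left p hρ.1 hsupp
  have hρ' : (ρ.submatrix (Subtype.val : {i // p i} → n) Subtype.val).PosSemidef := posSemidef_submatrix_val p hρ
  have htr' : (ρ.submatrix (Subtype.val : {i // p i} → n) Subtype.val).trace = 1 := by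
    rw [trace_submatrix_of_support p hsupp, htr]
  have h := (hH.submatrix (Subtype.val : {i // p i} → n)).vonNeumannEntropy_sub_mul_le_log_partitionFn β hρ' htr'
  rw [← vonNeumannEntropy_eq_submatrix_of_support p hρ.1 hsupp] at h
  have key := trace_submatrix_mul_submatrix_of_support p H hsupp hsupp'
  calc vonNeumannEntropy ρ - β * (ρ * H).trace.re
      = vonNeumannEntropy ρ - β * (ρ.submatrix (Subtype.val : {i // p i} → n) Subtype.val *
          H.submatrix (Subtype.val : {i // p i} → n) Subtype.val).trace.re := by rw [key]
    _ ≤ _ := h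

end Matrix

namespace Literature.MathematicalPhysics.QuantumLattice

open Matrix HubbardWave0

/-- **Gibbs variational principle for a canonical spin sector**: for Hermitian `H` on the Fock space of a finite ordered
orbital set and a density matrix `ρ` supported in the sector `(N↑, N↓) = (a, b)` (`ρ_{st} = 0` unless `spinConfig a b t`),
`S(ρ) − β Re tr(ρH) ≤ log Re Z_β(spinSectorHamiltonian a b H)`. [cite: Israel1979, Lemma II.3.1] -/
theorem vonNeumannEntropy_sub_mul_le_log_partitionFn_spinSector {Λ : Type*} [LinearOrder Λ] [Fintype Λ]
    {H : Matrix (Finset (Orb Λ)) (Finset (Orb Λ)) ℂ} (hH : H.IsHermitian) (β : ℝ) (a b : ℕ)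
    {ρ : Matrix (Finset (Orb Λ)) (Finset (Orb Λ)) ℂ} (hρ : ρ.PosSemidef) (htr : ρ.trace = 1)
    (hsupp : ∀ s t, ¬ spinConfig a b t → ρ s t = 0) :
    vonNeumannEntropy ρ - β * (ρ * H).trace.re ≤ Real.log (partitionFn β (spinSectorHamiltonian a b H)).re :=
  hH.vonNeumannEntropy_sub_mul_le_log_partitionFn_of_support β (spinConfig a b) hρ htr hsupp

end Literature.MathematicalPhysics.QuantumLattice

end
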